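import Mathlib
import Summits.Ventures.HodgeRepro2.Tier7.Line3.TwoVectorProjector
import Summits.Ventures.HodgeRepro2.Tier7.Line3.ProductProjector

/-!
# Tier7/Line3/TwoVectorComposite — `R(f_{ι₁}) ∘ R(f_fin)` for the REVISED (two-vector) `f` on the whole space
(seat t7-L1-p2, gen 3; memo v15 §2e (b) + §2g′)

With the line's compact-place test function the TWO-vector coefficient `f = mc τ b a` (`b = u_B`, `a = u_A`;
`TwoVectorProjector` p681253) and `f_fin` the normalised characteristic function of the level subgroup `K`
(`InvariantProjector` p679097), the factor `R(f) ∘ R(f_fin)` of §2e (b) is described on all of `H`: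

* `range_mul_eq_inf_of_right`: for a bounded `P` and an IDEMPOTENT bounded `Q` that commute,
  `range (P Q) = range P ⊓ range Q` (the left factor need not be idempotent);
* `commute_RopTwo_avgCLM` (`ProductProjector.integratedForm_comm`), **`range_RopTwo_mul_avgCLM`** (`b ≠ 0`):
  `range (R(f) ∘ R(f_fin)) = {ι a | ι equivariant} ⊓ fixed` — the `K`-invariant `u_A`-vectors of the embedded copies
  of `τ`, exactly;
* **`RopTwo_mul_avgCLM_sq`**: `(R(f) R(f_fin))² = ⟪b, a⟫ • (R(f) R(f_fin))`;
* **`adjoint_RopTwo_mul_avgCLM`**: `(R(f) R(f_fin))† = R(mc τ a b) R(f_fin)` — the swapped coefficient times the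
  same invariant projector (the `T†` of p4's `FiniteRankAdjoint` for the composite).

Dictionary and printed finiteness in words as before; nothing here is about (N). No sorry; axioms ⊆ {propext,
Classical.choice, Quot.sound}.
-/

namespace Summit.Ventures.HodgeRepro2.Tier7.Line3.TwoVectorComposite

open MeasureTheory
open scoped InnerProductSpace
open Summit.Ventures.HodgeRepro2.Tier7.Line3.SchurProjector (IsIrreducible)
open Summit.Ventures.HodgeRepro2.Tier7.Line3.OneVectorProjector (mc continuous_mc)
open Summit.Ventures.HodgeRepro2.Tier7.Line3.InvariantProjector
open Summit.Ventures.HodgeRepro2.Tier7.Line3.TwoVectorProjector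
open Summit.Ventures.HodgeRepro2.Tier7.Line3.ProductProjector (commute_integratedFormCLM)

section Range

variable {H : Type*} [NormedAddCommGroup H] [InnerProductSpace ℂ H]

/-- **the range of `P Q` for commuting `P`, `Q` with `Q` idempotent**: `range (P Q) = range P ⊓ range Q`. -/
theorem range_mul_eq_inf_of_right {P Q : H →L[ℂ] H} (hQ : IsIdempotentElem Q) (hPQ : Commute P Q) :
    LinearMap.range ((P * Q : H →L[ℂ] H) : H →ₗ[ℂ] H) =
      LinearMap.range (P : H →ₗ[ℂ] H) ⊓ LinearMap.range (Q : H →ₗ[ℂ] H) := by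
  have hQx : ∀ x, Q (Q x) = Q x := fun x => congrArg (fun T : H →L[ℂ] H => T x) hQ
  have hc : ∀ x, P (Q x) = Q (P x) := fun x => congrArg (fun T : H →L[ℂ] H => T x) hPQ.eq
  ext y
  simp only [Submodule.mem_inf, LinearMap.mem_range, ContinuousLinearMap.coe_coe, ContinuousLinearMap.mul_def,
    ContinuousLinearMap.comp_apply]
  constructor
  · rintro ⟨x, rfl⟩
    exact ⟨⟨Q x, rfl⟩, ⟨P x, (hc x).symm⟩⟩
  · rintro ⟨⟨z, rfl⟩, ⟨w, hw⟩⟩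
    refine ⟨z, ?_⟩
    rw [hc, ← hw, hQx, hw]

end Range

section Composite

variable {G : Type*} [Group G] [TopologicalSpace G] [IsTopologicalGroup G] [CompactSpace G]
  [MeasurableSpace G] [BorelSpace G] (μ : Measure G)
variable {K : Type*} [Group K] [TopologicalSpace K] [IsTopologicalGroup K] [CompactSpace K]
  [MeasurableSpace K] [BorelSpace K] (ν : Measure K)
variable {V : Type*} [NormedAddCommGroup V] [InnerProductSpace ℂ V] [FiniteDimensional ℂ V] [CompleteSpace V]
variable {H : Type*} [NormedAddCommGroup H] [InnerProductSpace ℂ H] [CompleteSpace H]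

omit [IsTopologicalGroup G] [IsTopologicalGroup K] [FiniteDimensional ℂ V] [CompleteSpace V] in
/-- `R(f)` and `R(f_fin)` commute (commuting actions of the two compact groups). -/
theorem commute_RopTwo_avgCLM [IsFiniteMeasure μ] [IsFiniteMeasure ν] {τ : G →* (V →L[ℂ] V)} (hτ : Continuous τ)
    {π : G →* (H →ₗ[ℂ] H)} (hπ : T7SupportWeightTorusOrbital.IsUnitaryRep π) (hc : ∀ x, Continuous fun g => π g x)
    (b a : V) {ρ : K →* (H →ₗ[ℂ] H)} (hρ : T7SupportWeightTorusOrbital.IsUnitaryRep ρ)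
    (hcρ : ∀ x, Continuous fun k => ρ k x) (hcomm : ∀ g k x, π g (ρ k x) = ρ k (π g x)) :
    Commute (RopTwo μ hτ hπ hc b a) (avgCLM ν hρ hcρ) :=
  commute_integratedFormCLM μ ν hπ hc (continuous_mc hτ b a) hρ hcρ continuous_const hcomm

/-- **the range of `R(f) ∘ R(f_fin)`** (`b ≠ 0`): the `K`-invariant `u_A`-vectors of the embedded copies of `τ`. -/
theorem range_RopTwo_mul_avgCLM [IsProbabilityMeasure μ] [μ.IsMulLeftInvariant] [IsProbabilityMeasure ν]
    [ν.IsMulLeftInvariant] {τ : G →* (V →L[ℂ] V)} (hτ : Continuous τ) (hτu : SchurProjector.IsUnitaryRep τ)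
    (hτi : IsIrreducible τ) {π : G →* (H →ₗ[ℂ] H)} (hπ : T7SupportWeightTorusOrbital.IsUnitaryRep π)
    (hc : ∀ x, Continuous fun g => π g x) {b : V} (hb : b ≠ 0) (a : V) {ρ : K →* (H →ₗ[ℂ] H)}
    (hρ : T7SupportWeightTorusOrbital.IsUnitaryRep ρ) (hcρ : ∀ x, Continuous fun k => ρ k x)
    (hcomm : ∀ g k x, π g (ρ k x) = ρ k (π g x)) (y : H) :
    y ∈ LinearMap.range ((RopTwo μ hτ hπ hc b a * avgCLM ν hρ hcρ : H →L[ℂ] H) : H →ₗ[ℂ] H) ↔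
      (∃ ι : V →ₗ[ℂ] H, (∀ g v, ι (τ g v) = π g (ι v)) ∧ ι a = y) ∧ y ∈ fixed ρ := by
  rw [range_mul_eq_inf_of_right (isIdempotentElem_avgCLM ν hρ hcρ) (commute_RopTwo_avgCLM μ ν hτ hπ hc b a hρ hcρ hcomm),
    Submodule.mem_inf, mem_range_RopTwo_iff μ hτ hτu hτi hπ hc hb a y, range_avgCLM_eq_fixed ν hρ hcρ]

/-- **`(R(f) R(f_fin))² = ⟪b, a⟫ • (R(f) R(f_fin))`**. -/
theorem RopTwo_mul_avgCLM_sq [IsProbabilityMeasure μ] [μ.IsMulLeftInvariant] [IsProbabilityMeasure ν]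
    [ν.IsMulLeftInvariant] {τ : G →* (V →L[ℂ] V)} (hτ : Continuous τ) (hτu : SchurProjector.IsUnitaryRep τ)
    (hτi : IsIrreducible τ) {π : G →* (H →ₗ[ℂ] H)} (hπ : T7SupportWeightTorusOrbital.IsUnitaryRep π)
    (hc : ∀ x, Continuous fun g => π g x) (b a : V) {ρ : K →* (H →ₗ[ℂ] H)}
    (hρ : T7SupportWeightTorusOrbital.IsUnitaryRep ρ) (hcρ : ∀ x, Continuous fun k => ρ k x)
    (hcomm : ∀ g k x, π g (ρ k x) = ρ k (π g x)) :
    (RopTwo μ hτ hπ hc b a * avgCLM ν hρ hcρ) * (RopTwo μ hτ hπ hc b a * avgCLM ν hρ hcρ) =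
      ⟪b, a⟫_ℂ • (RopTwo μ hτ hπ hc b a * avgCLM ν hρ hcρ) := by
  have hcm := commute_RopTwo_avgCLM μ ν hτ hπ hc b a hρ hcρ hcomm
  have hQ : avgCLM ν hρ hcρ * avgCLM ν hρ hcρ = avgCLM ν hρ hcρ := isIdempotentElem_avgCLM ν hρ hcρ
  have hT : RopTwo μ hτ hπ hc b a * RopTwo μ hτ hπ hc b a = ⟪b, a⟫_ℂ • RopTwo μ hτ hπ hc b a := by
    refine ContinuousLinearMap.ext fun x => ?_
    rw [ContinuousLinearMap.mul_def, ContinuousLinearMap.comp_apply, smul_apply, RopTwo_apply, RopTwo_apply]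
    exact integratedForm_two_integratedForm μ hτ hτu hτi hπ hc b a x
  calc (RopTwo μ hτ hπ hc b a * avgCLM ν hρ hcρ) * (RopTwo μ hτ hπ hc b a * avgCLM ν hρ hcρ)
      = RopTwo μ hτ hπ hc b a * (avgCLM ν hρ hcρ * RopTwo μ hτ hπ hc b a) * avgCLM ν hρ hcρ := by
        simp only [mul_assoc]
    _ = RopTwo μ hτ hπ hc b a * (RopTwo μ hτ hπ hc b a * avgCLM ν hρ hcρ) * avgCLM ν hρ hcρ := by
        rw [hcm.eq]
    _ = (RopTwo μ hτ hπ hc b a * RopTwo μ hτ hπ hc b a) * (avgCLM ν hρ hcρ * avgCLM ν hρ hcρ) := by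
        simp only [mul_assoc]
    _ = ⟪b, a⟫_ℂ • (RopTwo μ hτ hπ hc b a * avgCLM ν hρ hcρ) := by
        rw [hT, hQ, smul_mul_assoc]

omit [FiniteDimensional ℂ V] [CompleteSpace V] in
/-- **`(R(f) R(f_fin))† = R(mc τ a b) R(f_fin)`**: the adjoint of the composite is the composite with the vectors
swapped (`R(f_fin)` self-adjoint, the two factors commuting). -/
theorem adjoint_RopTwo_mul_avgCLM [μ.IsHaarMeasure] [IsProbabilityMeasure μ] [ν.IsHaarMeasure]
    [IsProbabilityMeasure ν] {τ : G →* (V →L[ℂ] V)} (hτ : Continuous τ) (hτu : SchurProjector.IsUnitaryRep τ)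
    {π : G →* (H →ₗ[ℂ] H)} (hπ : T7SupportWeightTorusOrbital.IsUnitaryRep π) (hc : ∀ x, Continuous fun g => π g x)
    (b a : V) {ρ : K →* (H →ₗ[ℂ] H)} (hρ : T7SupportWeightTorusOrbital.IsUnitaryRep ρ)
    (hcρ : ∀ x, Continuous fun k => ρ k x) (hcomm : ∀ g k x, π g (ρ k x) = ρ k (π g x)) :
    ContinuousLinearMap.adjoint (RopTwo μ hτ hπ hc b a * avgCLM ν hρ hcρ) =
      RopTwo μ hτ hπ hc a b * avgCLM ν hρ hcρ := by
  rw [ContinuousLinearMap.mul_def, ContinuousLinearMap.adjoint_comp, adjoint_RopTwo μ hτ hτu hπ hc b a,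
    (ContinuousLinearMap.isSelfAdjoint_iff'.1 (isSelfAdjoint_avgCLM ν hρ hcρ)), ← ContinuousLinearMap.mul_def,
    (commute_RopTwo_avgCLM μ ν hτ hπ hc a b hρ hcρ hcomm).eq]

end Composite

end Summit.Ventures.HodgeRepro2.Tier7.Line3.TwoVectorComposite
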